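import Literature.Analysis.PDE.HeatFreeFlowAdmissible
import Literature.Analysis.PDE.SobolevEnergy
import Literature.Analysis.FluidPDE.SpaceTimeCalculus
import Literature.Analysis.FunctionSpaces.IterDirDerivLeibniz
import HarnessLib

/-!
# Sobolev-energy estimates of every order for the forward Duhamel integral
# (topic `Analysis/PDE`)

Analytic layer of the programme to prove short-time existence for quasilinear strictly
parabolic systems on a closed manifold (hypothesis `hQL` of
`Literature.Geometry.Riemannian.ricciFlow_shortTime_existence_of_quasilinear`). The order-`0`
estimates of the forward Duhamel integral `V = 𝒱[Θ]` of a space–time test field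
(`HeatForwardDuhamel.lean`: energy `‖V(t)‖₂² ≤ 4(T-τ₀)Q`, gradient
`∫Σᵢ‖∂ᵢV‖₂² ≤ 2(T-τ₀)Q/ν`, maximal regularity `∫Σᵢⱼ‖∂ⱼ∂ᵢV‖₂² ≤ nQ/ν²`,
`Q = ∫_{τ₀}^T ‖Θ‖₂²`; `HeatFreeFlowAdmissible.lean`: the gradient at a fixed time
`Σᵢ‖∂ᵢV(t)‖₂² ≤ 2nQ/ν`) are lifted to EVERY Sobolev order `k`, with the same constants, in
the currency of the recursive directional energies `sobolevEnergy k` (`SobolevEnergy.lean`) and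
`ℝ≥0∞`-valued time integrals:

* `sobolevEnergy_heatDuhamelFwd_le` — `E_k(V(t)) ≤ 4(T-τ₀) ∫_{τ₀}^T E_k(Θ)` for `t ∈ [τ₀, T]`;
* `lintegral_sum_sobolevEnergy_fderiv_heatDuhamelFwd_le` —
  `∫_{τ₀}^T Σᵢ E_k(∂ᵢV) ≤ (2(T-τ₀)/ν) ∫_{τ₀}^T E_k(Θ)`;
* `lintegral_sum_sobolevEnergy_fderiv_fderiv_heatDuhamelFwd_le` —
  `∫_{τ₀}^T Σᵢⱼ E_k(∂ⱼ∂ᵢV) ≤ (n/ν²) ∫_{τ₀}^T E_k(Θ)` (maximal regularity, `T`-independent);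
* `sum_sobolevEnergy_fderiv_heatDuhamelFwd_le` — `Σᵢ E_k(∂ᵢV(t)) ≤ (2n/ν) ∫_{τ₀}^T E_k(Θ)`.

The induction on `k` is the recursion `E_{k+1}(f) = ∫‖f‖² + Σₗ E_k(∂ₗ f)` together with
"derivatives fall on the data" `∂ₗ 𝒱[Θ] = 𝒱[∂ₗΘ]` (`fderiv_heatDuhamelFwd_apply`) and
Schwarz's theorem on the data; the base case converts the real-valued interval-integral
statements of the tree into `lintegral` form (continuity and slab integrability of all fields
involved). Also: measurability in time of the slice energies of a jointly smooth field
(`measurable_sobolevEnergy_slice`).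

Everything is proved; no named fact and no `sorry` is introduced.

## References

* P. G. Lemarié-Rieusset, *The Navier–Stokes problem in the 21st century*, CRC Press 2016,
  Prop. 4.3 (B), (C), pp. 74–75. [LemarieRieusset2016]
* L. C. Evans, *Partial Differential Equations*, 2nd ed., AMS 2010, §2.3.1, Thm. 2; §7.1.3
  (higher regularity by differentiating the data). [Evans2010]
-/

noncomputable section

open MeasureTheory Set Function Filter Topology TopologicalSpace Metric InnerProductSpace
open scoped RealInnerProductSpace Laplacian ContDiff

namespace Literature.Analysis.PDE

open Literature.Analysis.UnboundedOperators Literature.Analysis.FluidPDE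
  Literature.Analysis.FunctionSpaces

variable {E : Type*} [NormedAddCommGroup E] [InnerProductSpace ℝ E] [FiniteDimensional ℝ E]
  [MeasurableSpace E] [BorelSpace E]
variable {F' : Type*} [NormedAddCommGroup F'] [InnerProductSpace ℝ F'] [FiniteDimensional ℝ F']

/-! ### Measurability in time of slice energies -/

omit [FiniteDimensional ℝ F'] in
/-- The slice energies `t ↦ E_k(F t)` of a jointly smooth field are measurable (Tonelli:
the integrands `(t, x) ↦ ‖∂_β(F t)(x)‖²` are continuous). [folklore] -/
theorem measurable_sobolevEnergy_slice (k : ℕ) :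
    ∀ {F : ℝ → E → F'}, IsSmoothSpaceTimeOn univ F → Measurable fun t ↦ sobolevEnergy k (F t) := by
  induction k with
  | zero =>
    intro F hF
    simp only [sobolevEnergy_zero_left]
    refine Measurable.lintegral_prod_right ?_
    have hc : Continuous (uncurry F) := by
      have h := hF
      rw [IsSmoothSpaceTimeOn, univ_prod_univ, contDiffOn_univ] at h
      exact h.continuous
    exact (continuous_enorm.comp hc).measurable.pow_const 2
  | succ k ih =>
    intro F hF
    simp only [sobolevEnergy_succ]
    refine Measurable.add ?_ (Finset.measurable_sum _ fun i _ ↦ ?_)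
    · refine Measurable.lintegral_prod_right ?_
      have hc : Continuous (uncurry F) := by
        have h := hF
        rw [IsSmoothSpaceTimeOn, univ_prod_univ, contDiffOn_univ] at h
        exact h.continuous
      exact (continuous_enorm.comp hc).measurable.pow_const 2
    · exact ih (hF.isSmoothSpaceTimeOn_fderiv_apply isOpen_univ _)

/-- The forward Duhamel integral of a space–time test field is jointly smooth. [folklore] -/
theorem isSmoothSpaceTimeOn_heatDuhamelFwd {ν : ℝ} (hν : 0 < ν) {Θ : ℝ → E → F'}
    (hΘ : IsSpaceTimeTestOn (⊤ : Opens (ℝ × E)) Θ) :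
    IsSmoothSpaceTimeOn univ (heatDuhamelFwd ν Θ) := by
  haveI : CompleteSpace F' := FiniteDimensional.complete ℝ F'
  exact (contDiff_uncurry_heatDuhamelFwd hΘ hν).contDiffOn

/-- Directional derivatives of the slices of `𝒱[Θ]` fall on the data (function form).
[folklore] -/
theorem fderiv_heatDuhamelFwd_eq {ν : ℝ} {Θ : ℝ → E → F'}
    (hΘ : IsSpaceTimeTestOn (⊤ : Opens (ℝ × E)) Θ) (hν : 0 < ν) (t : ℝ) (v : E) :
    (fun x ↦ fderiv ℝ (heatDuhamelFwd ν Θ t) x v) =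
      heatDuhamelFwd ν (fun s y ↦ fderiv ℝ (Θ s) y v) t := by
  haveI : CompleteSpace F' := FiniteDimensional.complete ℝ F'
  exact funext fun x ↦ fderiv_heatDuhamelFwd_apply hΘ hν t x v

/-! ### Conversion of real slab integrals to `lintegral` form -/

omit [InnerProductSpace ℝ F'] [FiniteDimensional ℝ F'] in
/-- For a continuous square-integrable slice, `∫⁻ ‖g‖ₑ² = ofReal (∫ ‖g‖²)`. [folklore] -/
theorem lintegral_enorm_sq_eq_ofReal [NormedSpace ℝ F'] {g : E → F'} (hg : MemLp g 2 volume) :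
    ∫⁻ x, ‖g x‖ₑ ^ 2 = ENNReal.ofReal (∫ x, ‖g x‖ ^ 2) := by
  have hi : Integrable (fun x ↦ ‖g x‖ ^ 2) volume := (memLp_two_iff_integrable_sq_norm hg.1).1 hg
  rw [ofReal_integral_eq_lintegral_ofReal hi (Eventually.of_forall fun x ↦ sq_nonneg _)]
  refine lintegral_congr fun x ↦ ?_
  rw [← ofReal_norm, ENNReal.ofReal_pow (norm_nonneg _)]

/-- Time integrals of slice integrals of a nonnegative jointly integrable function on a slab,
real form versus `lintegral` form. [folklore] -/
theorem lintegral_Ioo_lintegral_eq_ofReal {Φ : ℝ → E → ℝ} (hΦ : ∀ t x, 0 ≤ Φ t x)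
    {τ₀ T : ℝ} (hτ₀T : τ₀ ≤ T)
    (hint : Integrable (fun q : E × ℝ ↦ Φ q.2 q.1)
      ((volume : Measure E).prod (volume.restrict (Ioc τ₀ T)))) :
    ∫⁻ t in Ioo τ₀ T, ∫⁻ x, ENNReal.ofReal (Φ t x) = ENNReal.ofReal (∫ t in τ₀..T, ∫ x, Φ t x) := by
  rw [intervalIntegral.integral_of_le hτ₀T, ← integral_prod_symm _ hint,
    ofReal_integral_eq_lintegral_ofReal hint (Eventually.of_forall fun q ↦ hΦ _ _),
    lintegral_prod_symm _ (hint.aestronglyMeasurable.aemeasurable.ennreal_ofReal),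
    Measure.restrict_congr_set Ioo_ae_eq_Ioc]

/-! ### Slab integrability of the forward Duhamel integral -/

section Slab

variable {ν : ℝ} {Θ : ℝ → E → F'}

/-- `(x, t) ↦ ‖𝒱[Θ](t)(x)‖²` is integrable on every time slab `E × (τ, T]` (joint continuity,
boundedness, and uniformly bounded `L¹` slices on `t ≤ T`; the time variable is frozen above
`T`, which does not change the integrand on the slab). [folklore] -/
theorem integrable_prod_sq_norm_heatDuhamelFwd (hΘ : IsSpaceTimeTestOn (⊤ : Opens (ℝ × E)) Θ)
    (hν : 0 < ν) (τ T : ℝ) :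
    Integrable (fun q : E × ℝ ↦ ‖heatDuhamelFwd ν Θ q.2 q.1‖ ^ 2)
      ((volume : Measure E).prod (volume.restrict (Ioc τ T))) := by
  haveI : CompleteSpace F' := FiniteDimensional.complete ℝ F'
  have hrev := isSpaceTimeTestOn_timeReverse hΘ
  obtain ⟨M, -, hM⟩ := hrev.exists_norm_le
  obtain ⟨a, b, hab⟩ := hrev.exists_time_support
  obtain ⟨M₁, -, hM₁⟩ := hrev.exists_integral_norm_slice_le
  -- freeze time above `T`
  set U : ℝ → E → F' := fun s x ↦ heatDuhamelFwd ν Θ (min s T) x with hU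
  have hmin : Continuous fun s : ℝ ↦ min s T := continuous_id.min continuous_const
  have hUc : Continuous (uncurry U) := by
    have hc := (contDiff_uncurry_heatDuhamelFwd hΘ hν).continuous
    exact hc.comp ((hmin.comp continuous_fst).prodMk continuous_snd)
  have hUb : ∀ s x, ‖U s x‖ ≤ M * max (b - -T) 0 := fun s x ↦ by
    simp only [hU, heatDuhamelFwd_apply]
    refine (hrev.norm_heatDuhamelBack_le hν hM hab _ x).trans ?_
    refine mul_le_mul_of_nonneg_left (max_le_max ?_ le_rfl) ((norm_nonneg _).trans (hM 0 0))
    linarith [min_le_right s T]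
  have hUi : ∀ s, Integrable (U s) volume := fun s ↦ hrev.integrable_heatDuhamelBack hν _
  have hUL : ∀ s, ∫ x, ‖U s x‖ ≤ M₁ * max (b - -T) 0 := fun s ↦ by
    simp only [hU, heatDuhamelFwd_apply]
    refine (hrev.integral_norm_heatDuhamelBack_le hν hM₁ hab _).trans ?_
    refine mul_le_mul_of_nonneg_left (max_le_max ?_ le_rfl) ?_
    · linarith [min_le_right s T]
    · exact (integral_nonneg fun _ ↦ norm_nonneg _).trans (hM₁ 0)
  have hint := integrable_prod_inner_of_bound hUc hUc hUb hUi hUL τ T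
  refine hint.congr ?_
  have hmeas : ((volume : Measure E).prod (volume.restrict (Ioc τ T))) =
      ((volume : Measure E).prod (volume : Measure ℝ)).restrict (univ ×ˢ Ioc τ T) := by
    rw [← Measure.prod_restrict, Measure.restrict_univ]
  rw [hmeas]
  filter_upwards [ae_restrict_mem (MeasurableSet.univ.prod measurableSet_Ioc)] with q hq
  have hq2 : min q.2 T = q.2 := min_eq_left (mem_prod.1 hq).2.2
  simp only [hU, hq2, real_inner_self_eq_norm_sq]

/-- The same for the spatial directional derivatives `∂ᵥ𝒱[Θ] = 𝒱[∂ᵥΘ]`. [folklore] -/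
theorem integrable_prod_sq_norm_fderiv_heatDuhamelFwd
    (hΘ : IsSpaceTimeTestOn (⊤ : Opens (ℝ × E)) Θ) (hν : 0 < ν) (v : E) (τ T : ℝ) :
    Integrable (fun q : E × ℝ ↦ ‖fderiv ℝ (heatDuhamelFwd ν Θ q.2) q.1 v‖ ^ 2)
      ((volume : Measure E).prod (volume.restrict (Ioc τ T))) := by
  haveI : CompleteSpace F' := FiniteDimensional.complete ℝ F'
  have h := integrable_prod_sq_norm_heatDuhamelFwd (hΘ.fderiv_apply_top v) hν τ T
  refine h.congr (Eventually.of_forall fun q ↦ ?_)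
  simp only [fderiv_heatDuhamelFwd_apply hΘ hν]

end Slab

/-! ### The estimates at order zero in `lintegral` form -/

omit [InnerProductSpace ℝ F'] [FiniteDimensional ℝ F'] in
/-- `‖a‖ₑ² = ofReal (‖a‖²)`. [folklore] -/
theorem enorm_sq_eq_ofReal (a : F') : ‖a‖ₑ ^ 2 = ENNReal.ofReal (‖a‖ ^ 2) := by
  rw [← ofReal_norm, ENNReal.ofReal_pow (norm_nonneg _)]

/-- Finite sums of `lintegral`s of nonnegative continuous real functions. [folklore] -/
theorem sum_lintegral_ofReal_eq {ι : Type*} (s : Finset ι) {φ : ι → E → ℝ}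
    (h0 : ∀ i x, 0 ≤ φ i x) (hc : ∀ i, Continuous (φ i)) :
    ∑ i ∈ s, ∫⁻ x, ENNReal.ofReal (φ i x) = ∫⁻ x, ENNReal.ofReal (∑ i ∈ s, φ i x) := by
  rw [← lintegral_finsetSum' _ fun i _ ↦ (hc i).measurable.ennreal_ofReal.aemeasurable]
  refine lintegral_congr fun x ↦ ?_
  rw [ENNReal.ofReal_sum_of_nonneg fun i _ ↦ h0 i x]

section Zero

variable {ν : ℝ} {Θ : ℝ → E → F'}

omit [FiniteDimensional ℝ F'] in
/-- The `lintegral` form of the data functional: `∫_{τ₀}^T E_0(Θ) = ofReal (∫∫‖Θ‖²)`.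
[folklore] -/
theorem lintegral_sobolevEnergy_zero_eq_ofReal (hΘ : IsSpaceTimeTestOn (⊤ : Opens (ℝ × E)) Θ)
    {τ₀ T : ℝ} (hτ₀T : τ₀ ≤ T) :
    ∫⁻ t in Ioo τ₀ T, sobolevEnergy 0 (Θ t) =
      ENNReal.ofReal (∫ t in τ₀..T, ∫ x, ‖Θ t x‖ ^ 2) := by
  have h := lintegral_Ioo_lintegral_eq_ofReal (Φ := fun t x ↦ ‖Θ t x‖ ^ 2)
    (fun t x ↦ sq_nonneg _) hτ₀T (hΘ.integrable_prod_sq_norm τ₀ T)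
  rw [← h]
  refine lintegral_congr fun t ↦ ?_
  simp only [sobolevEnergy_zero_left, enorm_sq_eq_ofReal]

/-- Continuity of the second spatial derivatives of the slices of `𝒱[Θ]`. [folklore] -/
theorem continuous_fderiv_fderiv_heatDuhamelFwd (hΘ : IsSpaceTimeTestOn (⊤ : Opens (ℝ × E)) Θ)
    (hν : 0 < ν) (t : ℝ) (v w : E) :
    Continuous fun x ↦ fderiv ℝ (fun y ↦ fderiv ℝ (heatDuhamelFwd ν Θ t) y v) x w := by
  haveI : CompleteSpace F' := FiniteDimensional.complete ℝ F'
  have h1 : ContDiff ℝ ∞ fun y ↦ fderiv ℝ (heatDuhamelFwd ν Θ t) y v :=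
    ((contDiff_heatDuhamelFwd hΘ hν t).fderiv_right (m := ∞) (by norm_cast)).clm_apply
      contDiff_const
  exact (h1.continuous_fderiv (by simp)).clm_apply continuous_const

/-- Continuity of the first spatial derivatives of the slices of `𝒱[Θ]`. [folklore] -/
theorem continuous_fderiv_heatDuhamelFwd (hΘ : IsSpaceTimeTestOn (⊤ : Opens (ℝ × E)) Θ)
    (hν : 0 < ν) (t : ℝ) (v : E) :
    Continuous fun x ↦ fderiv ℝ (heatDuhamelFwd ν Θ t) x v := by
  haveI : CompleteSpace F' := FiniteDimensional.complete ℝ F'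
  exact ((contDiff_heatDuhamelFwd hΘ hν t).continuous_fderiv (by simp)).clm_apply
    continuous_const

/-- Energy estimate, order `0`, `lintegral` form. [cite: LemarieRieusset2016, Prop. 4.3 (B)] -/
theorem lintegral_enorm_sq_heatDuhamelFwd_le (hΘ : IsSpaceTimeTestOn (⊤ : Opens (ℝ × E)) Θ)
    (hν : 0 < ν) {τ₀ b : ℝ} (hab : ∀ s, s ∉ Icc τ₀ b → Θ s = 0) {T : ℝ} (hτ₀T : τ₀ ≤ T)
    {t : ℝ} (ht : t ∈ Icc τ₀ T) :
    ∫⁻ x, ‖heatDuhamelFwd ν Θ t x‖ₑ ^ 2 ≤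
      ENNReal.ofReal (4 * (T - τ₀)) * ∫⁻ s in Ioo τ₀ T, sobolevEnergy 0 (Θ s) := by
  haveI : CompleteSpace F' := FiniteDimensional.complete ℝ F'
  obtain ⟨h0, -⟩ := energy_estimate_heatDuhamelFwd hΘ hν hab hτ₀T
  rw [lintegral_sobolevEnergy_zero_eq_ofReal hΘ hτ₀T,
    lintegral_enorm_sq_eq_ofReal ((isHeatAdmissible_heatDuhamelFwd hν hΘ t).memLp_two),
    ← ENNReal.ofReal_mul (by linarith [ht.1, ht.2] : (0 : ℝ) ≤ 4 * (T - τ₀))]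
  exact ENNReal.ofReal_le_ofReal (h0 t ht)

/-- Gradient-at-a-time estimate, order `0`, `lintegral` form. [cite: LemarieRieusset2016, Prop. 4.3 (C)] -/
theorem sum_lintegral_enorm_sq_fderiv_heatDuhamelFwd_le
    (hΘ : IsSpaceTimeTestOn (⊤ : Opens (ℝ × E)) Θ) (hν : 0 < ν) {τ₀ b : ℝ}
    (hab : ∀ s, s ∉ Icc τ₀ b → Θ s = 0) {T : ℝ} (hτ₀T : τ₀ ≤ T) {t : ℝ} (ht : t ∈ Icc τ₀ T) :
    ∑ i, ∫⁻ x, ‖fderiv ℝ (heatDuhamelFwd ν Θ t) x (stdOrthonormalBasis ℝ E i)‖ₑ ^ 2 ≤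
      ENNReal.ofReal (2 * (Module.finrank ℝ E : ℝ) / ν) *
        ∫⁻ s in Ioo τ₀ T, sobolevEnergy 0 (Θ s) := by
  haveI : CompleteSpace F' := FiniteDimensional.complete ℝ F'
  have h := sum_integral_norm_sq_fderiv_heatDuhamelFwd_le hΘ hν hab ht.1 ht.2
  rw [lintegral_sobolevEnergy_zero_eq_ofReal hΘ hτ₀T,
    ← ENNReal.ofReal_mul (by positivity : (0 : ℝ) ≤ 2 * (Module.finrank ℝ E : ℝ) / ν)]
  have hconv : ∑ i, ∫⁻ x, ‖fderiv ℝ (heatDuhamelFwd ν Θ t) x (stdOrthonormalBasis ℝ E i)‖ₑ ^ 2 =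
      ENNReal.ofReal (∑ i, ∫ x, ‖fderiv ℝ (heatDuhamelFwd ν Θ t) x
        (stdOrthonormalBasis ℝ E i)‖ ^ 2) := by
    rw [ENNReal.ofReal_sum_of_nonneg fun i _ ↦ integral_nonneg fun _ ↦ sq_nonneg _]
    refine Finset.sum_congr rfl fun i _ ↦ ?_
    exact lintegral_enorm_sq_eq_ofReal (((isHeatAdmissible_heatDuhamelFwd hν hΘ t).fderiv_apply
      (stdOrthonormalBasis ℝ E i)).memLp_two)
  rw [hconv]
  exact ENNReal.ofReal_le_ofReal h

/-- Gradient estimate, order `0`, `lintegral` form. [cite: LemarieRieusset2016, Prop. 4.3 (B)] -/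
theorem lintegral_sum_enorm_sq_fderiv_heatDuhamelFwd_le
    (hΘ : IsSpaceTimeTestOn (⊤ : Opens (ℝ × E)) Θ) (hν : 0 < ν) {τ₀ b : ℝ}
    (hab : ∀ s, s ∉ Icc τ₀ b → Θ s = 0) {T : ℝ} (hτ₀T : τ₀ ≤ T) :
    ∫⁻ t in Ioo τ₀ T, ∑ i, ∫⁻ x,
        ‖fderiv ℝ (heatDuhamelFwd ν Θ t) x (stdOrthonormalBasis ℝ E i)‖ₑ ^ 2 ≤
      ENNReal.ofReal (2 * (T - τ₀) / ν) * ∫⁻ s in Ioo τ₀ T, sobolevEnergy 0 (Θ s) := by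
  haveI : CompleteSpace F' := FiniteDimensional.complete ℝ F'
  obtain ⟨-, h1⟩ := energy_estimate_heatDuhamelFwd hΘ hν hab hτ₀T
  have hT : 0 ≤ T - τ₀ := by linarith
  rw [lintegral_sobolevEnergy_zero_eq_ofReal hΘ hτ₀T,
    ← ENNReal.ofReal_mul (by positivity : (0 : ℝ) ≤ 2 * (T - τ₀) / ν)]
  have hint : ∀ i, Integrable (fun q : E × ℝ ↦ ‖fderiv ℝ (heatDuhamelFwd ν Θ q.2) q.1 ((stdOrthonormalBasis ℝ E) i)‖ ^ 2)
      ((volume : Measure E).prod (volume.restrict (Ioc τ₀ T))) := fun i ↦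
    integrable_prod_sq_norm_fderiv_heatDuhamelFwd hΘ hν ((stdOrthonormalBasis ℝ E) i) τ₀ T
  have hsum := lintegral_Ioo_lintegral_eq_ofReal
    (Φ := fun t x ↦ ∑ i, ‖fderiv ℝ (heatDuhamelFwd ν Θ t) x ((stdOrthonormalBasis ℝ E) i)‖ ^ 2)
    (fun t x ↦ Finset.sum_nonneg fun i _ ↦ sq_nonneg _) hτ₀T
    (integrable_finsetSum _ fun i _ ↦ hint i)
  have hlhs : ∫⁻ t in Ioo τ₀ T, ∑ i, ∫⁻ x, ‖fderiv ℝ (heatDuhamelFwd ν Θ t) x ((stdOrthonormalBasis ℝ E) i)‖ₑ ^ 2 =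
      ∫⁻ t in Ioo τ₀ T, ∫⁻ x,
        ENNReal.ofReal (∑ i, ‖fderiv ℝ (heatDuhamelFwd ν Θ t) x ((stdOrthonormalBasis ℝ E) i)‖ ^ 2) := by
    refine lintegral_congr fun t ↦ ?_
    simp only [enorm_sq_eq_ofReal]
    exact sum_lintegral_ofReal_eq _ (fun i x ↦ sq_nonneg _)
      fun i ↦ (continuous_fderiv_heatDuhamelFwd hΘ hν t ((stdOrthonormalBasis ℝ E) i)).norm.pow 2
  have hrhs : ∫ t in τ₀..T, ∫ x, ∑ i, ‖fderiv ℝ (heatDuhamelFwd ν Θ t) x ((stdOrthonormalBasis ℝ E) i)‖ ^ 2 =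
      ∫ t in τ₀..T, ∑ i, ∫ x, ‖fderiv ℝ (heatDuhamelFwd ν Θ t) x ((stdOrthonormalBasis ℝ E) i)‖ ^ 2 := by
    refine intervalIntegral.integral_congr fun t _ ↦ ?_
    refine integral_finsetSum _ fun i _ ↦ ?_
    have hm := ((isHeatAdmissible_heatDuhamelFwd hν hΘ t).fderiv_apply ((stdOrthonormalBasis ℝ E) i)).memLp_two
    exact (memLp_two_iff_integrable_sq_norm hm.1).1 hm
  rw [hlhs, hsum, hrhs]
  exact ENNReal.ofReal_le_ofReal h1

/-- Maximal regularity, order `0`, `lintegral` form. [cite: LemarieRieusset2016, Prop. 4.3 (C)] -/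
theorem lintegral_sum_enorm_sq_fderiv_fderiv_heatDuhamelFwd_le
    (hΘ : IsSpaceTimeTestOn (⊤ : Opens (ℝ × E)) Θ) (hν : 0 < ν) {τ₀ b : ℝ}
    (hab : ∀ s, s ∉ Icc τ₀ b → Θ s = 0) {T : ℝ} (hτ₀T : τ₀ ≤ T) :
    ∫⁻ t in Ioo τ₀ T, ∑ i, ∑ j, ∫⁻ x,
        ‖fderiv ℝ (fun y ↦ fderiv ℝ (heatDuhamelFwd ν Θ t) y (stdOrthonormalBasis ℝ E i)) x
          (stdOrthonormalBasis ℝ E j)‖ₑ ^ 2 ≤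
      ENNReal.ofReal ((Module.finrank ℝ E : ℝ) / ν ^ 2) *
        ∫⁻ s in Ioo τ₀ T, sobolevEnergy 0 (Θ s) := by
  haveI : CompleteSpace F' := FiniteDimensional.complete ℝ F'
  have h2 := maximalRegularity_heatDuhamelFwd hΘ hν hab hτ₀T
  rw [lintegral_sobolevEnergy_zero_eq_ofReal hΘ hτ₀T,
    ← ENNReal.ofReal_mul (by positivity : (0 : ℝ) ≤ (Module.finrank ℝ E : ℝ) / ν ^ 2)]
  have hΘi : ∀ i, IsSpaceTimeTestOn (⊤ : Opens (ℝ × E)) (fun s y ↦ fderiv ℝ (Θ s) y ((stdOrthonormalBasis ℝ E) i)) :=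
    fun i ↦ hΘ.fderiv_apply_top ((stdOrthonormalBasis ℝ E) i)
  have hVij : ∀ i j t x, fderiv ℝ (fun y ↦ fderiv ℝ (heatDuhamelFwd ν Θ t) y ((stdOrthonormalBasis ℝ E) i)) x ((stdOrthonormalBasis ℝ E) j) =
      fderiv ℝ (heatDuhamelFwd ν (fun s y ↦ fderiv ℝ (Θ s) y ((stdOrthonormalBasis ℝ E) i)) t) x ((stdOrthonormalBasis ℝ E) j) := by
    intro i j t x
    rw [fderiv_heatDuhamelFwd_eq hΘ hν t ((stdOrthonormalBasis ℝ E) i)]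
  have hint : ∀ i j, Integrable (fun q : E × ℝ ↦
      ‖fderiv ℝ (fun y ↦ fderiv ℝ (heatDuhamelFwd ν Θ q.2) y ((stdOrthonormalBasis ℝ E) i)) q.1 ((stdOrthonormalBasis ℝ E) j)‖ ^ 2)
      ((volume : Measure E).prod (volume.restrict (Ioc τ₀ T))) := fun i j ↦ by
    have h := integrable_prod_sq_norm_fderiv_heatDuhamelFwd (hΘi i) hν ((stdOrthonormalBasis ℝ E) j) τ₀ T
    refine h.congr (Eventually.of_forall fun q ↦ ?_)
    simp only [hVij]
  have hsum := lintegral_Ioo_lintegral_eq_ofReal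
    (Φ := fun t x ↦ ∑ i, ∑ j,
      ‖fderiv ℝ (fun y ↦ fderiv ℝ (heatDuhamelFwd ν Θ t) y ((stdOrthonormalBasis ℝ E) i)) x ((stdOrthonormalBasis ℝ E) j)‖ ^ 2)
    (fun t x ↦ Finset.sum_nonneg fun i _ ↦ Finset.sum_nonneg fun j _ ↦ sq_nonneg _) hτ₀T
    (integrable_finsetSum _ fun i _ ↦ integrable_finsetSum _ fun j _ ↦ hint i j)
  have hlhs : ∫⁻ t in Ioo τ₀ T, ∑ i, ∑ j, ∫⁻ x,
      ‖fderiv ℝ (fun y ↦ fderiv ℝ (heatDuhamelFwd ν Θ t) y ((stdOrthonormalBasis ℝ E) i)) x ((stdOrthonormalBasis ℝ E) j)‖ₑ ^ 2 =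
      ∫⁻ t in Ioo τ₀ T, ∫⁻ x, ENNReal.ofReal (∑ i, ∑ j,
        ‖fderiv ℝ (fun y ↦ fderiv ℝ (heatDuhamelFwd ν Θ t) y ((stdOrthonormalBasis ℝ E) i)) x ((stdOrthonormalBasis ℝ E) j)‖ ^ 2) := by
    refine lintegral_congr fun t ↦ ?_
    simp only [enorm_sq_eq_ofReal]
    have hin : ∀ i, ∑ j, ∫⁻ x, ENNReal.ofReal
        (‖fderiv ℝ (fun y ↦ fderiv ℝ (heatDuhamelFwd ν Θ t) y ((stdOrthonormalBasis ℝ E) i)) x ((stdOrthonormalBasis ℝ E) j)‖ ^ 2) =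
        ∫⁻ x, ENNReal.ofReal (∑ j,
          ‖fderiv ℝ (fun y ↦ fderiv ℝ (heatDuhamelFwd ν Θ t) y ((stdOrthonormalBasis ℝ E) i)) x ((stdOrthonormalBasis ℝ E) j)‖ ^ 2) := fun i ↦
      sum_lintegral_ofReal_eq _ (fun j x ↦ sq_nonneg _)
        fun j ↦ (continuous_fderiv_fderiv_heatDuhamelFwd hΘ hν t ((stdOrthonormalBasis ℝ E) i) ((stdOrthonormalBasis ℝ E) j)).norm.pow 2
    simp only [hin]
    exact sum_lintegral_ofReal_eq _ (fun i x ↦ Finset.sum_nonneg fun j _ ↦ sq_nonneg _)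
      fun i ↦ continuous_finsetSum _ fun j _ ↦
        (continuous_fderiv_fderiv_heatDuhamelFwd hΘ hν t ((stdOrthonormalBasis ℝ E) i) ((stdOrthonormalBasis ℝ E) j)).norm.pow 2
  have hrhs : ∫ t in τ₀..T, ∫ x, ∑ i, ∑ j,
      ‖fderiv ℝ (fun y ↦ fderiv ℝ (heatDuhamelFwd ν Θ t) y ((stdOrthonormalBasis ℝ E) i)) x ((stdOrthonormalBasis ℝ E) j)‖ ^ 2 =
      ∫ t in τ₀..T, ∑ i, ∑ j, ∫ x,
        ‖fderiv ℝ (fun y ↦ fderiv ℝ (heatDuhamelFwd ν Θ t) y ((stdOrthonormalBasis ℝ E) i)) x ((stdOrthonormalBasis ℝ E) j)‖ ^ 2 := by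
    refine intervalIntegral.integral_congr fun t _ ↦ ?_
    have hij : ∀ i j, Integrable (fun x ↦
        ‖fderiv ℝ (fun y ↦ fderiv ℝ (heatDuhamelFwd ν Θ t) y ((stdOrthonormalBasis ℝ E) i)) x ((stdOrthonormalBasis ℝ E) j)‖ ^ 2) volume := by
      intro i j
      have hm := (((isHeatAdmissible_heatDuhamelFwd hν hΘ t).fderiv_apply ((stdOrthonormalBasis ℝ E) i)).fderiv_apply
        ((stdOrthonormalBasis ℝ E) j)).memLp_two
      exact (memLp_two_iff_integrable_sq_norm hm.1).1 hm
    rw [integral_finsetSum _ fun i _ ↦ integrable_finsetSum _ fun j _ ↦ hij i j]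
    exact Finset.sum_congr rfl fun i _ ↦ integral_finsetSum _ fun j _ ↦ hij i j
  rw [hlhs, hsum, hrhs]
  exact ENNReal.ofReal_le_ofReal h2

end Zero

/-! ### The estimates at every order -/

section AllOrders

variable {ν : ℝ}

omit [FiniteDimensional ℝ E] [MeasurableSpace E] [BorelSpace E] [FiniteDimensional ℝ F'] in
/-- Schwarz on the data: `∂ₗ∂ᵢΘ = ∂ᵢ∂ₗΘ` slicewise for a space–time test field. [folklore] -/
theorem fderiv_fderiv_slice_comm {Θ : ℝ → E → F'}
    (hΘ : IsSpaceTimeTestOn (⊤ : Opens (ℝ × E)) Θ) (s : ℝ) (v w : E) :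
    (fun y ↦ fderiv ℝ (fun z ↦ fderiv ℝ (Θ s) z v) y w) =
      fun y ↦ fderiv ℝ (fun z ↦ fderiv ℝ (Θ s) z w) y v := by
  have h := iterDirDeriv_singleton_comm (hΘ.contDiff_slice s) w v
  simpa [FunctionSpaces.iterDirDeriv] using h

omit [FiniteDimensional ℝ F'] in
/-- The time integral of the data energies splits along the recursion:
`∫ E_{k+1}(Θ) = ∫ E_0(Θ) + Σₗ ∫ E_k(∂ₗΘ)`. [folklore] -/
theorem lintegral_sobolevEnergy_succ_slice {Θ : ℝ → E → F'} (hΘ : IsSmoothSpaceTimeOn univ Θ)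
    (k : ℕ) (S : Set ℝ) :
    ∫⁻ s in S, sobolevEnergy (k + 1) (Θ s) = (∫⁻ s in S, sobolevEnergy 0 (Θ s)) +
      ∑ l, ∫⁻ s in S, sobolevEnergy k (fun y ↦ fderiv ℝ (Θ s) y (stdOrthonormalBasis ℝ E l)) := by
  have hA : Measurable fun s ↦ ∫⁻ x, ‖Θ s x‖ₑ ^ 2 := by
    simpa using measurable_sobolevEnergy_slice 0 hΘ
  simp only [sobolevEnergy_succ, sobolevEnergy_zero_left]
  rw [lintegral_add_left hA, lintegral_finsetSum']
  exact fun l _ ↦ (measurable_sobolevEnergy_slice k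
    (hΘ.isSmoothSpaceTimeOn_fderiv_apply isOpen_univ _)).aemeasurable

/-- **Energy estimate at every order**: for a space–time test field `Θ` vanishing for
`s ∉ [τ₀, b]` and `τ₀ ≤ t ≤ T`, `E_k(𝒱[Θ](t)) ≤ 4(T - τ₀) ∫_{τ₀}^T E_k(Θ(s)) ds`.
[cite: LemarieRieusset2016, Prop. 4.3 (B)] -/
theorem sobolevEnergy_heatDuhamelFwd_le (hν : 0 < ν) (k : ℕ) :
    ∀ {Θ : ℝ → E → F'}, IsSpaceTimeTestOn (⊤ : Opens (ℝ × E)) Θ → ∀ {τ₀ b : ℝ},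
      (∀ s, s ∉ Icc τ₀ b → Θ s = 0) → ∀ {T : ℝ}, τ₀ ≤ T → ∀ {t : ℝ}, t ∈ Icc τ₀ T →
        sobolevEnergy k (heatDuhamelFwd ν Θ t) ≤
          ENNReal.ofReal (4 * (T - τ₀)) * ∫⁻ s in Ioo τ₀ T, sobolevEnergy k (Θ s) := by
  haveI : CompleteSpace F' := FiniteDimensional.complete ℝ F'
  induction k with
  | zero =>
    intro Θ hΘ τ₀ b hab T hτ₀T t ht
    rw [sobolevEnergy_zero_left]
    exact lintegral_enorm_sq_heatDuhamelFwd_le hΘ hν hab hτ₀T ht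
  | succ k ih =>
    intro Θ hΘ τ₀ b hab T hτ₀T t ht
    have hΘl : ∀ l, IsSpaceTimeTestOn (⊤ : Opens (ℝ × E)) (fun s y ↦ fderiv ℝ (Θ s) y ((stdOrthonormalBasis ℝ E) l)) :=
      fun l ↦ hΘ.fderiv_apply_top ((stdOrthonormalBasis ℝ E) l)
    have habl : ∀ l s, s ∉ Icc τ₀ b → (fun y ↦ fderiv ℝ (Θ s) y ((stdOrthonormalBasis ℝ E) l)) = 0 := fun l s hs ↦ by
      funext y
      simp [hab s hs]
    rw [sobolevEnergy_succ, lintegral_sobolevEnergy_succ_slice (hΘ.isSmoothSpaceTimeOn univ),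
      mul_add, Finset.mul_sum]
    refine add_le_add (lintegral_enorm_sq_heatDuhamelFwd_le hΘ hν hab hτ₀T ht)
      (Finset.sum_le_sum fun l _ ↦ ?_)
    rw [fderiv_heatDuhamelFwd_eq hΘ hν t ((stdOrthonormalBasis ℝ E) l)]
    exact ih (hΘl l) (habl l) hτ₀T ht

/-- **Gradient-at-a-time estimate at every order**: `Σᵢ E_k(∂ᵢ𝒱[Θ](t)) ≤ (2n/ν) ∫_{τ₀}^T E_k(Θ)`
for `τ₀ ≤ t ≤ T`. [cite: LemarieRieusset2016, Prop. 4.3 (C)] -/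
theorem sum_sobolevEnergy_fderiv_heatDuhamelFwd_le (hν : 0 < ν) (k : ℕ) :
    ∀ {Θ : ℝ → E → F'}, IsSpaceTimeTestOn (⊤ : Opens (ℝ × E)) Θ → ∀ {τ₀ b : ℝ},
      (∀ s, s ∉ Icc τ₀ b → Θ s = 0) → ∀ {T : ℝ}, τ₀ ≤ T → ∀ {t : ℝ}, t ∈ Icc τ₀ T →
        ∑ i, sobolevEnergy k (fun x ↦ fderiv ℝ (heatDuhamelFwd ν Θ t) x (stdOrthonormalBasis ℝ E i)) ≤
          ENNReal.ofReal (2 * (Module.finrank ℝ E : ℝ) / ν) *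
            ∫⁻ s in Ioo τ₀ T, sobolevEnergy k (Θ s) := by
  haveI : CompleteSpace F' := FiniteDimensional.complete ℝ F'
  induction k with
  | zero =>
    intro Θ hΘ τ₀ b hab T hτ₀T t ht
    simp only [sobolevEnergy_zero_left]
    exact sum_lintegral_enorm_sq_fderiv_heatDuhamelFwd_le hΘ hν hab hτ₀T ht
  | succ k ih =>
    intro Θ hΘ τ₀ b hab T hτ₀T t ht
    have hΘl : ∀ l, IsSpaceTimeTestOn (⊤ : Opens (ℝ × E)) (fun s y ↦ fderiv ℝ (Θ s) y ((stdOrthonormalBasis ℝ E) l)) :=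
      fun l ↦ hΘ.fderiv_apply_top ((stdOrthonormalBasis ℝ E) l)
    have habl : ∀ l s, s ∉ Icc τ₀ b → (fun y ↦ fderiv ℝ (Θ s) y ((stdOrthonormalBasis ℝ E) l)) = 0 := fun l s hs ↦ by
      funext y
      simp [hab s hs]
    rw [lintegral_sobolevEnergy_succ_slice (hΘ.isSmoothSpaceTimeOn univ),
      mul_add, Finset.mul_sum]
    simp only [sobolevEnergy_succ, Finset.sum_add_distrib]
    refine add_le_add ?_ ?_
    · have h := sum_lintegral_enorm_sq_fderiv_heatDuhamelFwd_le hΘ hν hab hτ₀T ht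
      simpa only [sobolevEnergy_zero_left] using h
    · -- `Σᵢ Σₗ E_k(∂ₗ∂ᵢV) = Σₗ Σᵢ E_k(∂ᵢ 𝒱[∂ₗΘ])`
      rw [Finset.sum_comm]
      refine Finset.sum_le_sum fun l _ ↦ ?_
      have heq : ∀ i, (fun x ↦ fderiv ℝ (fun y ↦ fderiv ℝ (heatDuhamelFwd ν Θ t) y ((stdOrthonormalBasis ℝ E) i)) x ((stdOrthonormalBasis ℝ E) l)) =
          fun x ↦ fderiv ℝ (heatDuhamelFwd ν (fun s y ↦ fderiv ℝ (Θ s) y ((stdOrthonormalBasis ℝ E) l)) t) x ((stdOrthonormalBasis ℝ E) i) := by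
        intro i
        rw [fderiv_heatDuhamelFwd_eq hΘ hν t ((stdOrthonormalBasis ℝ E) i), fderiv_heatDuhamelFwd_eq (hΘ.fderiv_apply_top _) hν t ((stdOrthonormalBasis ℝ E) l),
          fderiv_heatDuhamelFwd_eq (hΘl l) hν t ((stdOrthonormalBasis ℝ E) i)]
        congr 1
        funext s
        exact fderiv_fderiv_slice_comm hΘ s ((stdOrthonormalBasis ℝ E) i) ((stdOrthonormalBasis ℝ E) l)
      simp only [heq]
      exact ih (hΘl l) (habl l) hτ₀T ht

/-- **Gradient estimate at every order**: `∫_{τ₀}^T Σᵢ E_k(∂ᵢ𝒱[Θ]) ≤ (2(T-τ₀)/ν) ∫_{τ₀}^T E_k(Θ)`.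
[cite: LemarieRieusset2016, Prop. 4.3 (B)] -/
theorem lintegral_sum_sobolevEnergy_fderiv_heatDuhamelFwd_le (hν : 0 < ν) (k : ℕ) :
    ∀ {Θ : ℝ → E → F'}, IsSpaceTimeTestOn (⊤ : Opens (ℝ × E)) Θ → ∀ {τ₀ b : ℝ},
      (∀ s, s ∉ Icc τ₀ b → Θ s = 0) → ∀ {T : ℝ}, τ₀ ≤ T →
        ∫⁻ t in Ioo τ₀ T, ∑ i, sobolevEnergy k
            (fun x ↦ fderiv ℝ (heatDuhamelFwd ν Θ t) x (stdOrthonormalBasis ℝ E i)) ≤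
          ENNReal.ofReal (2 * (T - τ₀) / ν) * ∫⁻ s in Ioo τ₀ T, sobolevEnergy k (Θ s) := by
  haveI : CompleteSpace F' := FiniteDimensional.complete ℝ F'
  induction k with
  | zero =>
    intro Θ hΘ τ₀ b hab T hτ₀T
    simp only [sobolevEnergy_zero_left]
    exact lintegral_sum_enorm_sq_fderiv_heatDuhamelFwd_le hΘ hν hab hτ₀T
  | succ k ih =>
    intro Θ hΘ τ₀ b hab T hτ₀T
    have hV := isSmoothSpaceTimeOn_heatDuhamelFwd hν hΘ
    have hΘl : ∀ l, IsSpaceTimeTestOn (⊤ : Opens (ℝ × E)) (fun s y ↦ fderiv ℝ (Θ s) y ((stdOrthonormalBasis ℝ E) l)) :=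
      fun l ↦ hΘ.fderiv_apply_top ((stdOrthonormalBasis ℝ E) l)
    have habl : ∀ l s, s ∉ Icc τ₀ b → (fun y ↦ fderiv ℝ (Θ s) y ((stdOrthonormalBasis ℝ E) l)) = 0 := fun l s hs ↦ by
      funext y
      simp [hab s hs]
    -- split the left-hand side (measurability from joint smoothness)
    have hVi : ∀ i, IsSmoothSpaceTimeOn univ (fun t x ↦ fderiv ℝ (heatDuhamelFwd ν Θ t) x ((stdOrthonormalBasis ℝ E) i)) :=
      fun i ↦ hV.isSmoothSpaceTimeOn_fderiv_apply isOpen_univ _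
    have hmeas0 : ∀ i, Measurable fun t ↦ ∫⁻ x, ‖fderiv ℝ (heatDuhamelFwd ν Θ t) x ((stdOrthonormalBasis ℝ E) i)‖ₑ ^ 2 :=
      fun i ↦ by simpa using measurable_sobolevEnergy_slice 0 (hVi i)
    have hmeask : ∀ i l, Measurable fun t ↦ sobolevEnergy k
        (fun x ↦ fderiv ℝ (fun y ↦ fderiv ℝ (heatDuhamelFwd ν Θ t) y ((stdOrthonormalBasis ℝ E) i)) x ((stdOrthonormalBasis ℝ E) l)) :=
      fun i l ↦ measurable_sobolevEnergy_slice k ((hVi i).isSmoothSpaceTimeOn_fderiv_apply isOpen_univ _)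
    rw [lintegral_sobolevEnergy_succ_slice (hΘ.isSmoothSpaceTimeOn univ),
      mul_add, Finset.mul_sum]
    simp only [sobolevEnergy_succ]
    have hsplit : ∫⁻ t in Ioo τ₀ T, ∑ i, ((∫⁻ x, ‖fderiv ℝ (heatDuhamelFwd ν Θ t) x ((stdOrthonormalBasis ℝ E) i)‖ₑ ^ 2) +
        ∑ l, sobolevEnergy k (fun x ↦ fderiv ℝ
          (fun y ↦ fderiv ℝ (heatDuhamelFwd ν Θ t) y ((stdOrthonormalBasis ℝ E) i)) x ((stdOrthonormalBasis ℝ E) l))) =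
        (∫⁻ t in Ioo τ₀ T, ∑ i, ∫⁻ x, ‖fderiv ℝ (heatDuhamelFwd ν Θ t) x ((stdOrthonormalBasis ℝ E) i)‖ₑ ^ 2) +
          ∑ l, ∫⁻ t in Ioo τ₀ T, ∑ i, sobolevEnergy k (fun x ↦ fderiv ℝ
            (fun y ↦ fderiv ℝ (heatDuhamelFwd ν Θ t) y ((stdOrthonormalBasis ℝ E) i)) x ((stdOrthonormalBasis ℝ E) l)) := by
      rw [← lintegral_finsetSum' _ fun l _ ↦
        (Finset.measurable_sum _ fun i _ ↦ hmeask i l).aemeasurable,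
        ← lintegral_add_left (Finset.measurable_sum _ fun i _ ↦ hmeas0 i)]
      refine lintegral_congr fun t ↦ ?_
      rw [Finset.sum_add_distrib, Finset.sum_comm]
    rw [hsplit]
    refine add_le_add ?_ (Finset.sum_le_sum fun l _ ↦ ?_)
    · have h := lintegral_sum_enorm_sq_fderiv_heatDuhamelFwd_le hΘ hν hab hτ₀T
      simpa only [sobolevEnergy_zero_left] using h
    · have heq : ∀ t i, (fun x ↦ fderiv ℝ (fun y ↦ fderiv ℝ (heatDuhamelFwd ν Θ t) y ((stdOrthonormalBasis ℝ E) i)) x ((stdOrthonormalBasis ℝ E) l)) =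
          fun x ↦ fderiv ℝ (heatDuhamelFwd ν (fun s y ↦ fderiv ℝ (Θ s) y ((stdOrthonormalBasis ℝ E) l)) t) x ((stdOrthonormalBasis ℝ E) i) := by
        intro t i
        rw [fderiv_heatDuhamelFwd_eq hΘ hν t ((stdOrthonormalBasis ℝ E) i), fderiv_heatDuhamelFwd_eq (hΘ.fderiv_apply_top _) hν t ((stdOrthonormalBasis ℝ E) l),
          fderiv_heatDuhamelFwd_eq (hΘl l) hν t ((stdOrthonormalBasis ℝ E) i)]
        congr 1
        funext s
        exact fderiv_fderiv_slice_comm hΘ s ((stdOrthonormalBasis ℝ E) i) ((stdOrthonormalBasis ℝ E) l)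
      simp only [heq]
      exact ih (hΘl l) (habl l) hτ₀T

/-- **Maximal regularity at every order**: `∫_{τ₀}^T Σᵢⱼ E_k(∂ⱼ∂ᵢ𝒱[Θ]) ≤ (n/ν²) ∫_{τ₀}^T E_k(Θ)`
(`T`-independent). [cite: LemarieRieusset2016, Prop. 4.3 (C)] -/
theorem lintegral_sum_sobolevEnergy_fderiv_fderiv_heatDuhamelFwd_le (hν : 0 < ν) (k : ℕ) :
    ∀ {Θ : ℝ → E → F'}, IsSpaceTimeTestOn (⊤ : Opens (ℝ × E)) Θ → ∀ {τ₀ b : ℝ},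
      (∀ s, s ∉ Icc τ₀ b → Θ s = 0) → ∀ {T : ℝ}, τ₀ ≤ T →
        ∫⁻ t in Ioo τ₀ T, ∑ i, ∑ j, sobolevEnergy k (fun x ↦
            fderiv ℝ (fun y ↦ fderiv ℝ (heatDuhamelFwd ν Θ t) y (stdOrthonormalBasis ℝ E i)) x
              (stdOrthonormalBasis ℝ E j)) ≤
          ENNReal.ofReal ((Module.finrank ℝ E : ℝ) / ν ^ 2) *
            ∫⁻ s in Ioo τ₀ T, sobolevEnergy k (Θ s) := by
  haveI : CompleteSpace F' := FiniteDimensional.complete ℝ F'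
  induction k with
  | zero =>
    intro Θ hΘ τ₀ b hab T hτ₀T
    simp only [sobolevEnergy_zero_left]
    exact lintegral_sum_enorm_sq_fderiv_fderiv_heatDuhamelFwd_le hΘ hν hab hτ₀T
  | succ k ih =>
    intro Θ hΘ τ₀ b hab T hτ₀T
    have hV := isSmoothSpaceTimeOn_heatDuhamelFwd hν hΘ
    have hΘl : ∀ l, IsSpaceTimeTestOn (⊤ : Opens (ℝ × E)) (fun s y ↦ fderiv ℝ (Θ s) y ((stdOrthonormalBasis ℝ E) l)) :=
      fun l ↦ hΘ.fderiv_apply_top ((stdOrthonormalBasis ℝ E) l)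
    have habl : ∀ l s, s ∉ Icc τ₀ b → (fun y ↦ fderiv ℝ (Θ s) y ((stdOrthonormalBasis ℝ E) l)) = 0 := fun l s hs ↦ by
      funext y
      simp [hab s hs]
    have hVij : ∀ i j, IsSmoothSpaceTimeOn univ (fun t x ↦
        fderiv ℝ (fun y ↦ fderiv ℝ (heatDuhamelFwd ν Θ t) y ((stdOrthonormalBasis ℝ E) i)) x ((stdOrthonormalBasis ℝ E) j)) := fun i j ↦
      (hV.isSmoothSpaceTimeOn_fderiv_apply isOpen_univ _).isSmoothSpaceTimeOn_fderiv_apply isOpen_univ _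
    have hmeas0 : ∀ i j, Measurable fun t ↦ ∫⁻ x,
        ‖fderiv ℝ (fun y ↦ fderiv ℝ (heatDuhamelFwd ν Θ t) y ((stdOrthonormalBasis ℝ E) i)) x ((stdOrthonormalBasis ℝ E) j)‖ₑ ^ 2 :=
      fun i j ↦ by simpa using measurable_sobolevEnergy_slice 0 (hVij i j)
    have hmeask : ∀ i j l, Measurable fun t ↦ sobolevEnergy k (fun x ↦ fderiv ℝ
        (fun z ↦ fderiv ℝ (fun y ↦ fderiv ℝ (heatDuhamelFwd ν Θ t) y ((stdOrthonormalBasis ℝ E) i)) z ((stdOrthonormalBasis ℝ E) j)) x ((stdOrthonormalBasis ℝ E) l)) :=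
      fun i j l ↦ measurable_sobolevEnergy_slice k
        ((hVij i j).isSmoothSpaceTimeOn_fderiv_apply isOpen_univ _)
    rw [lintegral_sobolevEnergy_succ_slice (hΘ.isSmoothSpaceTimeOn univ),
      mul_add, Finset.mul_sum]
    simp only [sobolevEnergy_succ]
    have hsplit : ∫⁻ t in Ioo τ₀ T, ∑ i, ∑ j,
        ((∫⁻ x, ‖fderiv ℝ (fun y ↦ fderiv ℝ (heatDuhamelFwd ν Θ t) y ((stdOrthonormalBasis ℝ E) i)) x ((stdOrthonormalBasis ℝ E) j)‖ₑ ^ 2) +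
          ∑ l, sobolevEnergy k (fun x ↦ fderiv ℝ (fun z ↦ fderiv ℝ
            (fun y ↦ fderiv ℝ (heatDuhamelFwd ν Θ t) y ((stdOrthonormalBasis ℝ E) i)) z ((stdOrthonormalBasis ℝ E) j)) x ((stdOrthonormalBasis ℝ E) l))) =
        (∫⁻ t in Ioo τ₀ T, ∑ i, ∑ j, ∫⁻ x,
          ‖fderiv ℝ (fun y ↦ fderiv ℝ (heatDuhamelFwd ν Θ t) y ((stdOrthonormalBasis ℝ E) i)) x ((stdOrthonormalBasis ℝ E) j)‖ₑ ^ 2) +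
          ∑ l, ∫⁻ t in Ioo τ₀ T, ∑ i, ∑ j, sobolevEnergy k (fun x ↦ fderiv ℝ (fun z ↦ fderiv ℝ
            (fun y ↦ fderiv ℝ (heatDuhamelFwd ν Θ t) y ((stdOrthonormalBasis ℝ E) i)) z ((stdOrthonormalBasis ℝ E) j)) x ((stdOrthonormalBasis ℝ E) l)) := by
      rw [← lintegral_finsetSum' _ fun l _ ↦ (Finset.measurable_sum _ fun i _ ↦
          Finset.measurable_sum _ fun j _ ↦ hmeask i j l).aemeasurable,
        ← lintegral_add_left (Finset.measurable_sum _ fun i _ ↦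
          Finset.measurable_sum _ fun j _ ↦ hmeas0 i j)]
      refine lintegral_congr fun t ↦ ?_
      simp only [Finset.sum_add_distrib]
      congr 1
      symm
      rw [Finset.sum_comm]
      refine Finset.sum_congr rfl fun i _ ↦ ?_
      rw [Finset.sum_comm]
    rw [hsplit]
    refine add_le_add ?_ (Finset.sum_le_sum fun l _ ↦ ?_)
    · have h := lintegral_sum_enorm_sq_fderiv_fderiv_heatDuhamelFwd_le hΘ hν hab hτ₀T
      simpa only [sobolevEnergy_zero_left] using h
    · -- `∂ₗ∂ⱼ∂ᵢV = ∂ⱼ∂ᵢ 𝒱[∂ₗΘ]`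
      have heq : ∀ t i j, (fun x ↦ fderiv ℝ (fun z ↦ fderiv ℝ
          (fun y ↦ fderiv ℝ (heatDuhamelFwd ν Θ t) y ((stdOrthonormalBasis ℝ E) i)) z ((stdOrthonormalBasis ℝ E) j)) x ((stdOrthonormalBasis ℝ E) l)) =
          fun x ↦ fderiv ℝ (fun y ↦ fderiv ℝ
            (heatDuhamelFwd ν (fun s y ↦ fderiv ℝ (Θ s) y ((stdOrthonormalBasis ℝ E) l)) t) y ((stdOrthonormalBasis ℝ E) i)) x ((stdOrthonormalBasis ℝ E) j) := by
        intro t i j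
        have hΘi := hΘ.fderiv_apply_top ((stdOrthonormalBasis ℝ E) i)
        have hΘij := hΘi.fderiv_apply_top ((stdOrthonormalBasis ℝ E) j)
        -- left: `𝒱[∂ₗ∂ⱼ∂ᵢΘ]`, right: `𝒱[∂ⱼ∂ᵢ∂ₗΘ]`
        rw [fderiv_heatDuhamelFwd_eq hΘ hν t ((stdOrthonormalBasis ℝ E) i), fderiv_heatDuhamelFwd_eq hΘi hν t ((stdOrthonormalBasis ℝ E) j),
          fderiv_heatDuhamelFwd_eq hΘij hν t ((stdOrthonormalBasis ℝ E) l),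
          fderiv_heatDuhamelFwd_eq (hΘl l) hν t ((stdOrthonormalBasis ℝ E) i),
          fderiv_heatDuhamelFwd_eq ((hΘl l).fderiv_apply_top ((stdOrthonormalBasis ℝ E) i)) hν t ((stdOrthonormalBasis ℝ E) j)]
        congr 1
        funext s
        -- `∂ₗ∂ⱼ∂ᵢθ = ∂ⱼ∂ₗ∂ᵢθ = ∂ⱼ∂ᵢ∂ₗθ`
        have h1 := fderiv_fderiv_slice_comm hΘi s ((stdOrthonormalBasis ℝ E) j) ((stdOrthonormalBasis ℝ E) l)
        rw [h1]
        have h2 : (fun z ↦ fderiv ℝ (fun y ↦ fderiv ℝ (Θ s) y ((stdOrthonormalBasis ℝ E) i)) z ((stdOrthonormalBasis ℝ E) l)) =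
            fun z ↦ fderiv ℝ (fun y ↦ fderiv ℝ (Θ s) y ((stdOrthonormalBasis ℝ E) l)) z ((stdOrthonormalBasis ℝ E) i) :=
          fderiv_fderiv_slice_comm hΘ s ((stdOrthonormalBasis ℝ E) i) ((stdOrthonormalBasis ℝ E) l)
        rw [h2]
      simp only [heq]
      exact ih (hΘl l) (habl l) hτ₀T

end AllOrders

end Literature.Analysis.PDE

end
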